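import Summits.CriticalPhenomena.PercolationContinuityZ3.Theorems.Transplant.FKConnectivityAllQPat3MinorRecursion
import HarnessLib

/-!
# Connectivity correlation inequalities for `φ_{w,q}`, every `q > 0` — THEOREM SP on MINORS: all marks inner; the parallel-case dispatch

Proof file (`--supports stmt-CriticalPhenomena-4575`), census lineage (gen 37) of LANE 2's FK sub-programme; builds on p205010
(kernel theorem, internal audit signed; external expert review pending).  No definitions, no named facts, no sorries.

The minor version of `…Pat3SPAllInner.lean` (a minor `(E, C)` of the network rides along unchanged; restriction to the pieces only
at the leaves): `FK.pcC_good` (all three marks inner on one parallel part), the parallel-case dispatch `FK.parC_twoTerm`,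
`FK.parC_oneTerm`, `FK.parC_noTerm`, `FK.parC_termFirst`, assembled in `FK.spGoodC_parallel`.  Used by `…Pat3TheoremSPMinor.lean`.
[cite: AyyerLinussonRavichandran2025, §7 (p. 22)] [cite: Grimmett2006, §3.8 (pp. 61–62)]
-/

namespace Summit.CriticalPhenomena.PercolationContinuityZ3.Theorems

namespace FK

open SimpleGraph Literature.Probability.LatticeModels Literature.Probability.Percolation
open scoped Classical

variable {V : Type*} [Fintype V]

/-! ### All marks inner on one parallel part: the recursion `pc` on minors -/

section AllInnerC

variable {F₁ F₂ E₂ : Finset (Sym2 V)} {x m y : V} {E C : Finset (Sym2 V)}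

/-- All marks on the series part with the junction marked, on minors: CORNER or `pbC` after re-rooting.
[cite: AyyerLinussonRavichandran2025, §7 (p. 22)] -/
theorem pcC_junction {p q : V} (h₂ : IsTTSP E₂ x y) (hd : Disjoint (F₁ ∪ F₂) E₂)
    (hV : ∀ z : V, (∃ e ∈ F₁ ∪ F₂, z ∈ e) → (∃ e ∈ E₂, z ∈ e) → z = x ∨ z = y)
    (hF₁ : IsTTSP F₁ x m) (hF₂ : IsTTSP F₂ m y) (hdF : Disjoint F₁ F₂)
    (hVF : ∀ z : V, (∃ e ∈ F₁, z ∈ e) → (∃ e ∈ F₂, z ∈ e) → z = m) (hxF₂ : ∀ e ∈ F₂, x ∉ e) (hyF₁ : ∀ e ∈ F₁, y ∉ e)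
    (hE : E ⊆ F₁ ∪ F₂ ∪ E₂) (hC : C ⊆ F₁ ∪ F₂ ∪ E₂)
    (hp : ∃ e ∈ F₁ ∪ F₂, p ∈ e) (hq : ∃ e ∈ F₁ ∪ F₂, q ∈ e) (hpm : p ≠ m) (hpx : p ≠ x) (hpy : p ≠ y)
    (hqm : q ≠ m) (hqx : q ≠ x) (hqy : q ≠ y) (hpq : p ≠ q) : SPGoodC E C m p q := by
  have iE : ∀ A : Finset (Sym2 V), E ∩ A ⊆ A := fun A => Finset.inter_subset_right
  have iC : ∀ A : Finset (Sym2 V), C ∩ A ⊆ A := fun A => Finset.inter_subset_right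
  obtain ⟨hA, hdA, hVA⟩ := reroot_serA h₂ hd hV hF₁ hF₂ hdF hVF hxF₂ hyF₁
  obtain ⟨hB, hdB, hVB⟩ := reroot_serB h₂ hd hV hF₁ hF₂ hdF hVF hxF₂ hyF₁
  have eA : F₁ ∪ F₂ ∪ E₂ = F₁ ∪ (F₂ ∪ E₂) := Finset.union_assoc _ _ _
  have eB : F₁ ∪ F₂ ∪ E₂ = F₂ ∪ (F₁ ∪ E₂) := by ext e; simp only [Finset.mem_union]; tauto
  rcases span_union hp with hp1 | hp2 <;> rcases span_union hq with hq1 | hq2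
  · exact pbC_good F₁.card le_rfl hF₁.symm hA hdA hVA (eA ▸ hE) (eA ▸ hC) hp1 hq1 hpm hpx hqm hqx hpq
  · exact (spGoodC_corner hdA hVA hF₁.symm hA (iE _) (iC _) (iE _) (iC _) hp1 ⟨hq2.choose, Finset.mem_union_left _
      hq2.choose_spec.1, hq2.choose_spec.2⟩ hpm hpx hqm hqx).congr_sets (inter_union2_eq hE eA) (inter_union2_eq hC eA)
  · exact (spGoodC_corner hdA hVA hF₁.symm hA (iE _) (iC _) (iE _) (iC _) hq1 ⟨hp2.choose, Finset.mem_union_left _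
      hp2.choose_spec.1, hp2.choose_spec.2⟩ hqm hqx hpm hpx).swap23.congr_sets (inter_union2_eq hE eA)
      (inter_union2_eq hC eA)
  · exact pbC_good F₂.card le_rfl hF₂ hB hdB hVB (eB ▸ hE) (eB ▸ hC) hp2 hq2 hpm hpy hqm hqy hpq

/-- **ALL MARKS INNER ON ONE PART, ON MINORS.** [cite: AyyerLinussonRavichandran2025, §7 (p. 22)] -/
theorem pcC_good : ∀ (n : ℕ) {E₁ E₂ E C : Finset (Sym2 V)} {x y b s t : V}, E₁.card ≤ n →
    IsTTSP E₁ x y → IsTTSP E₂ x y → Disjoint E₁ E₂ →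
    (∀ z : V, (∃ e ∈ E₁, z ∈ e) → (∃ e ∈ E₂, z ∈ e) → z = x ∨ z = y) →
    E ⊆ E₁ ∪ E₂ → C ⊆ E₁ ∪ E₂ →
    (∃ e ∈ E₁, b ∈ e) → (∃ e ∈ E₁, s ∈ e) → (∃ e ∈ E₁, t ∈ e) →
    b ≠ x → b ≠ y → s ≠ x → s ≠ y → t ≠ x → t ≠ y → b ≠ s → b ≠ t → s ≠ t → SPGoodC E C b s t := by
  intro n
  induction n with
  | zero =>
    intro E₁ E₂ E C x y b s t hcard h₁ _ _ _ _ _ _ _ _ _ _ _ _ _ _ _ _ _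
    have := h₁.card_pos
    omega
  | succ n ih =>
    intro E₁ E₂ E C x y b s t hcard h₁ h₂ hd hV hE hC hb hs ht hbx hby hsx hsy htx hty hbs hbt hst
    cases h₁ with
    | edge hxy =>
      obtain ⟨e, he, hse⟩ := hs
      rw [Finset.mem_singleton] at he
      subst he
      rcases Sym2.mem_iff.1 hse with h | h
      · exact absurd h hsx
      · exact absurd h hsy
    | @parallel Q₁ Q₂ _ _ hQ₁ hQ₂ hdQ hVQ =>
      have hlt1 := card_left_lt_of_parallel hQ₂ hdQ
      have hlt2 := card_right_lt_of_parallel hQ₁ hdQ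
      obtain ⟨hP, hdP, hVP⟩ := reroot_par h₂ hd hV hQ₂ hdQ hVQ
      obtain ⟨hP', hdP', hVP'⟩ := reroot_par' h₂ hd hV hQ₁ hdQ hVQ
      have eA : Q₁ ∪ Q₂ ∪ E₂ = Q₁ ∪ (Q₂ ∪ E₂) := Finset.union_assoc _ _ _
      have eB : Q₁ ∪ Q₂ ∪ E₂ = Q₂ ∪ (Q₁ ∪ E₂) := by ext e; simp only [Finset.mem_union]; tauto
      have hEA := eA ▸ hE; have hCA := eA ▸ hC; have hEB := eB ▸ hE; have hCB := eB ▸ hC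
      have l1 : ∀ {p : V}, (∃ e ∈ Q₁, p ∈ e) → ∃ e ∈ Q₁ ∪ E₂, p ∈ e := fun ⟨e, he, hpe⟩ =>
        ⟨e, Finset.mem_union_left _ he, hpe⟩
      have l2 : ∀ {p : V}, (∃ e ∈ Q₂, p ∈ e) → ∃ e ∈ Q₂ ∪ E₂, p ∈ e := fun ⟨e, he, hpe⟩ =>
        ⟨e, Finset.mem_union_left _ he, hpe⟩
      rcases span_union hb with hb1 | hb2 <;> rcases span_union hs with hs1 | hs2 <;>
        rcases span_union ht with ht1 | ht2
      · exact ih (by omega) hQ₁ hP hdP hVP hEA hCA hb1 hs1 ht1 hbx hby hsx hsy htx hty hbs hbt hst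
      · exact (typeIC_good _ le_rfl hQ₁ hP hdP hVP hEA hCA hb1 hs1 (l2 ht2) hbx hby hsx hsy htx hty hbs).rotate
      · exact (typeIC_good _ le_rfl hQ₁ hP hdP hVP hEA hCA hb1 ht1 (l2 hs2) hbx hby htx hty hsx hsy hbt).rotate.swap23
      · exact typeIC_good _ le_rfl hQ₂ hP' hdP' hVP' hEB hCB hs2 ht2 (l1 hb1) hsx hsy htx hty hbx hby hst
      · exact typeIC_good _ le_rfl hQ₁ hP hdP hVP hEA hCA hs1 ht1 (l2 hb2) hsx hsy htx hty hbx hby hst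
      · exact (typeIC_good _ le_rfl hQ₂ hP' hdP' hVP' hEB hCB hb2 ht2 (l1 hs1) hbx hby htx hty hsx hsy hbt).rotate.swap23
      · exact (typeIC_good _ le_rfl hQ₂ hP' hdP' hVP' hEB hCB hb2 hs2 (l1 ht1) hbx hby hsx hsy htx hty hbs).rotate
      · exact ih (by omega) hQ₂ hP' hdP' hVP' hEB hCB hb2 hs2 ht2 hbx hby hsx hsy htx hty hbs hbt hst
    | @series F₁ F₂ _ m _ hF₁ hF₂ hdF hVF hxF₂ hyF₁ =>
      have hlt1 := card_left_lt_of_parallel hF₂ hdF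
      have hlt2 := card_right_lt_of_parallel hF₁ hdF
      by_cases hbm : b = m
      · subst hbm
        exact pcC_junction h₂ hd hV hF₁ hF₂ hdF hVF hxF₂ hyF₁ hE hC hs ht (Ne.symm hbs) hsx hsy (Ne.symm hbt) htx hty hst
      by_cases hsm : s = m
      · subst hsm
        exact (pcC_junction h₂ hd hV hF₁ hF₂ hdF hVF hxF₂ hyF₁ hE hC hb ht hbs hbx hby (Ne.symm hst) htx hty hbt).swap12
      by_cases htm : t = m
      · subst htm
        exact (pcC_junction h₂ hd hV hF₁ hF₂ hdF hVF hxF₂ hyF₁ hE hC hb hs hbt hbx hby hst hsx hsy hbs).rotate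
      obtain ⟨hA, hdA, hVA⟩ := reroot_serA h₂ hd hV hF₁ hF₂ hdF hVF hxF₂ hyF₁
      have hVA' : ∀ z : V, (∃ e ∈ F₁, z ∈ e) → (∃ e ∈ F₂ ∪ E₂, z ∈ e) → z = x ∨ z = m :=
        fun z h1 h => (hVA z h1 h).symm
      obtain ⟨hB, hdB, hVB⟩ := reroot_serB h₂ hd hV hF₁ hF₂ hdF hVF hxF₂ hyF₁
      have eA : F₁ ∪ F₂ ∪ E₂ = F₁ ∪ (F₂ ∪ E₂) := Finset.union_assoc _ _ _
      have eB : F₁ ∪ F₂ ∪ E₂ = F₂ ∪ (F₁ ∪ E₂) := by ext e; simp only [Finset.mem_union]; tauto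
      have hEA := eA ▸ hE; have hCA := eA ▸ hC; have hEB := eB ▸ hE; have hCB := eB ▸ hC
      have l1 : ∀ {p : V}, (∃ e ∈ F₁, p ∈ e) → ∃ e ∈ F₁ ∪ E₂, p ∈ e := fun ⟨e, he, hpe⟩ =>
        ⟨e, Finset.mem_union_left _ he, hpe⟩
      have l2 : ∀ {p : V}, (∃ e ∈ F₂, p ∈ e) → ∃ e ∈ F₂ ∪ E₂, p ∈ e := fun ⟨e, he, hpe⟩ =>
        ⟨e, Finset.mem_union_left _ he, hpe⟩
      rcases span_union hb with hb1 | hb2 <;> rcases span_union hs with hs1 | hs2 <;>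
        rcases span_union ht with ht1 | ht2
      · exact ih (by omega) hF₁ hA.symm hdA hVA' hEA hCA hb1 hs1 ht1 hbx hbm hsx hsm htx htm hbs hbt hst
      · exact (typeIC_good _ le_rfl hF₁ hA.symm hdA hVA' hEA hCA hb1 hs1 (l2 ht2) hbx hbm hsx hsm htx htm hbs).rotate
      · exact (typeIC_good _ le_rfl hF₁ hA.symm hdA hVA' hEA hCA hb1 ht1 (l2 hs2) hbx hbm htx htm hsx hsm
          hbt).rotate.swap23
      · exact typeIC_good _ le_rfl hF₂ hB hdB hVB hEB hCB hs2 ht2 (l1 hb1) hsm hsy htm hty hbm hby hst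
      · exact typeIC_good _ le_rfl hF₁ hA.symm hdA hVA' hEA hCA hs1 ht1 (l2 hb2) hsx hsm htx htm hbx hbm hst
      · exact (typeIC_good _ le_rfl hF₂ hB hdB hVB hEB hCB hb2 ht2 (l1 hs1) hbm hby htm hty hsm hsy hbt).rotate.swap23
      · exact (typeIC_good _ le_rfl hF₂ hB hdB hVB hEB hCB hb2 hs2 (l1 ht1) hbm hby hsm hsy htm hty hbs).rotate
      · exact ih (by omega) hF₂ hB hdB hVB hEB hCB hb2 hs2 ht2 hbm hby hsm hsy htm hty hbs hbt hst

end AllInnerC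

/-! ### The parallel case of the main induction on minors, by the number of marked terminals -/

section ParallelCaseC

variable {Q₁ Q₂ : Finset (Sym2 V)} {x y : V} {E C : Finset (Sym2 V)}

/-- Both terminals marked, the third mark inner, on minors. [cite: AyyerLinussonRavichandran2025, §7 (p. 22)] -/
theorem parC_twoTerm {r : V} (hQ₁ : IsTTSP Q₁ x y) (hQ₂ : IsTTSP Q₂ x y) (hdQ : Disjoint Q₁ Q₂)
    (hVQ : ∀ z : V, (∃ e ∈ Q₁, z ∈ e) → (∃ e ∈ Q₂, z ∈ e) → z = x ∨ z = y)
    (hE : E ⊆ Q₁ ∪ Q₂) (hC : C ⊆ Q₁ ∪ Q₂)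
    (hr : ∃ e ∈ Q₁ ∪ Q₂, r ∈ e) (hrx : r ≠ x) (hry : r ≠ y) : SPGoodC E C x y r := by
  have iE : ∀ A : Finset (Sym2 V), E ∩ A ⊆ A := fun A => Finset.inter_subset_right
  have iC : ∀ A : Finset (Sym2 V), C ∩ A ⊆ A := fun A => Finset.inter_subset_right
  rcases span_union hr with hr1 | hr2
  · have eB : Q₁ ∪ Q₂ = Q₂ ∪ Q₁ := Finset.union_comm _ _
    exact (spGoodC_parTwo hdQ.symm (fun z h2 h1 => hVQ z h1 h2) hQ₁.ne hQ₁ (iE _) (iC _) (iE _) (iC _) hr1 hrx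
      hry).congr_sets (inter_union2_eq hE eB) (inter_union2_eq hC eB)
  · exact (spGoodC_parTwo hdQ hVQ hQ₁.ne hQ₂ (iE _) (iC _) (iE _) (iC _) hr2 hrx hry).congr_sets (inter_union2_eq hE rfl)
      (inter_union2_eq hC rfl)

/-- Exactly the terminal `x` marked, the other two marks inner, on minors. [cite: AyyerLinussonRavichandran2025, §7 (p. 22)] -/
theorem parC_oneTerm {p q : V} (hQ₁ : IsTTSP Q₁ x y) (hQ₂ : IsTTSP Q₂ x y) (hdQ : Disjoint Q₁ Q₂)
    (hVQ : ∀ z : V, (∃ e ∈ Q₁, z ∈ e) → (∃ e ∈ Q₂, z ∈ e) → z = x ∨ z = y)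
    (hE : E ⊆ Q₁ ∪ Q₂) (hC : C ⊆ Q₁ ∪ Q₂)
    (hp : ∃ e ∈ Q₁ ∪ Q₂, p ∈ e) (hq : ∃ e ∈ Q₁ ∪ Q₂, q ∈ e) (hpx : p ≠ x) (hpy : p ≠ y) (hqx : q ≠ x) (hqy : q ≠ y)
    (hpq : p ≠ q) : SPGoodC E C x p q := by
  have iE : ∀ A : Finset (Sym2 V), E ∩ A ⊆ A := fun A => Finset.inter_subset_right
  have iC : ∀ A : Finset (Sym2 V), C ∩ A ⊆ A := fun A => Finset.inter_subset_right
  have eB : Q₁ ∪ Q₂ = Q₂ ∪ Q₁ := Finset.union_comm _ _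
  rcases span_union hp with hp1 | hp2 <;> rcases span_union hq with hq1 | hq2
  · exact pbC_good Q₁.card le_rfl hQ₁ hQ₂ hdQ hVQ hE hC hp1 hq1 hpx hpy hqx hqy hpq
  · exact (spGoodC_corner hdQ hVQ hQ₁ hQ₂ (iE _) (iC _) (iE _) (iC _) hp1 hq2 hpx hpy hqx hqy).congr_sets
      (inter_union2_eq hE rfl) (inter_union2_eq hC rfl)
  · exact (spGoodC_corner hdQ hVQ hQ₁ hQ₂ (iE _) (iC _) (iE _) (iC _) hq1 hp2 hqx hqy hpx hpy).swap23.congr_sets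
      (inter_union2_eq hE rfl) (inter_union2_eq hC rfl)
  · exact pbC_good Q₂.card le_rfl hQ₂ hQ₁ hdQ.symm (fun z h2 h1 => hVQ z h1 h2) (eB ▸ hE) (eB ▸ hC) hp2 hq2 hpx hpy hqx
      hqy hpq

/-- No terminal marked: all three marks inner, on minors. [cite: AyyerLinussonRavichandran2025, §7 (p. 22)] -/
theorem parC_noTerm {b s t : V} (hQ₁ : IsTTSP Q₁ x y) (hQ₂ : IsTTSP Q₂ x y) (hdQ : Disjoint Q₁ Q₂)
    (hVQ : ∀ z : V, (∃ e ∈ Q₁, z ∈ e) → (∃ e ∈ Q₂, z ∈ e) → z = x ∨ z = y)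
    (hE : E ⊆ Q₁ ∪ Q₂) (hC : C ⊆ Q₁ ∪ Q₂)
    (hb : ∃ e ∈ Q₁ ∪ Q₂, b ∈ e) (hs : ∃ e ∈ Q₁ ∪ Q₂, s ∈ e) (ht : ∃ e ∈ Q₁ ∪ Q₂, t ∈ e)
    (hbx : b ≠ x) (hby : b ≠ y) (hsx : s ≠ x) (hsy : s ≠ y) (htx : t ≠ x) (hty : t ≠ y)
    (hbs : b ≠ s) (hbt : b ≠ t) (hst : s ≠ t) : SPGoodC E C b s t := by
  have hdQ' : Disjoint Q₂ Q₁ := hdQ.symm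
  have hVQ' : ∀ z : V, (∃ e ∈ Q₂, z ∈ e) → (∃ e ∈ Q₁, z ∈ e) → z = x ∨ z = y := fun z h2 h1 => hVQ z h1 h2
  have eB : Q₁ ∪ Q₂ = Q₂ ∪ Q₁ := Finset.union_comm _ _
  have hEB := eB ▸ hE; have hCB := eB ▸ hC
  rcases span_union hb with hb1 | hb2 <;> rcases span_union hs with hs1 | hs2 <;> rcases span_union ht with ht1 | ht2
  · exact pcC_good Q₁.card le_rfl hQ₁ hQ₂ hdQ hVQ hE hC hb1 hs1 ht1 hbx hby hsx hsy htx hty hbs hbt hst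
  · exact (typeIC_good Q₁.card le_rfl hQ₁ hQ₂ hdQ hVQ hE hC hb1 hs1 ht2 hbx hby hsx hsy htx hty hbs).rotate
  · exact (typeIC_good Q₁.card le_rfl hQ₁ hQ₂ hdQ hVQ hE hC hb1 ht1 hs2 hbx hby htx hty hsx hsy hbt).rotate.swap23
  · exact typeIC_good Q₂.card le_rfl hQ₂ hQ₁ hdQ' hVQ' hEB hCB hs2 ht2 hb1 hsx hsy htx hty hbx hby hst
  · exact typeIC_good Q₁.card le_rfl hQ₁ hQ₂ hdQ hVQ hE hC hs1 ht1 hb2 hsx hsy htx hty hbx hby hst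
  · exact (typeIC_good Q₂.card le_rfl hQ₂ hQ₁ hdQ' hVQ' hEB hCB hb2 ht2 hs1 hbx hby htx hty hsx hsy hbt).rotate.swap23
  · exact (typeIC_good Q₂.card le_rfl hQ₂ hQ₁ hdQ' hVQ' hEB hCB hb2 hs2 ht1 hbx hby hsx hsy htx hty hbs).rotate
  · exact pcC_good Q₂.card le_rfl hQ₂ hQ₁ hdQ' hVQ' hEB hCB hb2 hs2 ht2 hbx hby hsx hsy htx hty hbs hbt hst

/-- One marked terminal `x` and two further distinct marks anywhere else, on minors. [cite: AyyerLinussonRavichandran2025, §7 (p. 22)] -/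
theorem parC_termFirst {p q : V} (hQ₁ : IsTTSP Q₁ x y) (hQ₂ : IsTTSP Q₂ x y) (hdQ : Disjoint Q₁ Q₂)
    (hVQ : ∀ z : V, (∃ e ∈ Q₁, z ∈ e) → (∃ e ∈ Q₂, z ∈ e) → z = x ∨ z = y)
    (hE : E ⊆ Q₁ ∪ Q₂) (hC : C ⊆ Q₁ ∪ Q₂)
    (hp : ∃ e ∈ Q₁ ∪ Q₂, p ∈ e) (hq : ∃ e ∈ Q₁ ∪ Q₂, q ∈ e) (hpx : p ≠ x) (hqx : q ≠ x) (hpq : p ≠ q) :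
    SPGoodC E C x p q := by
  by_cases hpy : p = y
  · subst hpy
    exact (parC_twoTerm hQ₁ hQ₂ hdQ hVQ hE hC hq hqx (Ne.symm hpq)).swap23.swap23
  by_cases hqy : q = y
  · subst hqy
    exact (parC_twoTerm hQ₁ hQ₂ hdQ hVQ hE hC hp hpx hpy).swap23
  exact parC_oneTerm hQ₁ hQ₂ hdQ hVQ hE hC hp hq hpx hpy hqx hqy hpq

/-- **THE PARALLEL CASE ON MINORS:** on a parallel composition of two two-terminal series–parallel networks, every minor `(E, C)`
and every placement of three distinct marks is good. [cite: AyyerLinussonRavichandran2025, §7 (p. 22)] -/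
theorem spGoodC_parallel {b s t : V} (hQ₁ : IsTTSP Q₁ x y) (hQ₂ : IsTTSP Q₂ x y) (hdQ : Disjoint Q₁ Q₂)
    (hVQ : ∀ z : V, (∃ e ∈ Q₁, z ∈ e) → (∃ e ∈ Q₂, z ∈ e) → z = x ∨ z = y)
    (hE : E ⊆ Q₁ ∪ Q₂) (hC : C ⊆ Q₁ ∪ Q₂)
    (hb : ∃ e ∈ Q₁ ∪ Q₂, b ∈ e) (hs : ∃ e ∈ Q₁ ∪ Q₂, s ∈ e) (ht : ∃ e ∈ Q₁ ∪ Q₂, t ∈ e)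
    (hbs : b ≠ s) (hbt : b ≠ t) (hst : s ≠ t) : SPGoodC E C b s t := by
  have hVQ' : ∀ z : V, (∃ e ∈ Q₁, z ∈ e) → (∃ e ∈ Q₂, z ∈ e) → z = y ∨ z = x := fun z h1 h2 => (hVQ z h1 h2).symm
  by_cases hbx : b = x
  · subst hbx
    exact parC_termFirst hQ₁ hQ₂ hdQ hVQ hE hC hs ht (Ne.symm hbs) (Ne.symm hbt) hst
  by_cases hby : b = y
  · subst hby
    exact parC_termFirst hQ₁.symm hQ₂.symm hdQ hVQ' hE hC hs ht (Ne.symm hbs) (Ne.symm hbt) hst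
  by_cases hsx : s = x
  · subst hsx
    exact (parC_termFirst hQ₁ hQ₂ hdQ hVQ hE hC hb ht hbx (Ne.symm hst) hbt).swap12
  by_cases hsy : s = y
  · subst hsy
    exact (parC_termFirst hQ₁.symm hQ₂.symm hdQ hVQ' hE hC hb ht hby (Ne.symm hst) hbt).swap12
  by_cases htx : t = x
  · subst htx
    exact (parC_termFirst hQ₁ hQ₂ hdQ hVQ hE hC hb hs hbx hsx hbs).rotate
  by_cases hty : t = y
  · subst hty
    exact (parC_termFirst hQ₁.symm hQ₂.symm hdQ hVQ' hE hC hb hs hby hsy hbs).rotate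
  exact parC_noTerm hQ₁ hQ₂ hdQ hVQ hE hC hb hs ht hbx hby hsx hsy htx hty hbs hbt hst

end ParallelCaseC

end FK

end Summit.CriticalPhenomena.PercolationContinuityZ3.Theorems
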